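import Mathlib
import HarnessLib
import Summits.Ventures.LatticeQCDFlow.Exactness.NCMCGeneralSpaceGammaMethodPlugIn

/-!
# Centring at the POOLED mean instead of the replica means (Wolff's `Γ̄`): on every path the two windowed autocovariance sums differ by at most `(2W+1) δ² + 8C δ W²/(N − W)`, `δ = |x̄ − c|` — the deterministic half of the equivalence of the two replica-pooled Γ-method statistics

HONEST FRAMING: exact (Metropolis-corrected) sampling algorithms for lattice gauge theory;
figures of merit are autocorrelation/cost numbers at stated couplings and volumes; no
continuum-physics claim.

Venture `LatticeQCDFlow` (cell pub-lqcd), topic `Exactness`; FANOUT row 13 (`eng-snf`, GEN-23).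
NEW WORK of the cell, not a published result; no definition is introduced; nothing is cited as a
fact (U. Wolff, *Monte Carlo errors with less errors*, Comput. Phys. Commun. 156 (2004) 143, §3.3,
eq. (31): with `R` replicas the autocorrelation function is estimated with the fluctuations
`a^{i,r} − ā̄` about the OVERALL mean `ā̄` and the normalisation `1/(N − R t)` — NAMED ONLY).
GEN-23's `NCMCGeneralSpaceReplicaPooledGammaCoverage` proves the exactness of the pooled error bar
built from the replica AVERAGE of scorer A's one-stream statistics, i.e. with every replica centred at
ITS OWN mean (row 11's `Scoring.gammaHat` centres at the sample mean of the series it is given), and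
lists the pooled-mean centring as NOT CLAIMED.  THIS file is the path-wise half of that item: for one
real series `x_0, …, x_{N−1}` with `|x_i| ≤ C`, centring the lag sums at an ARBITRARY constant `c`
instead of the sample mean `x̄` changes `Σ_{i<N−t} (x_i − ·)(x_{i+t} − ·)` by EXACTLY
`(x̄ − c)(Σ_{i<N−t} d_i + Σ_{i<N−t} d_{i+t}) + (N − t)(x̄ − c)²` (`d = x − x̄`), and the two partial
sums of deviations are tails of at most `t` terms of a zero-sum sequence, so each is `≤ 2C t` in
absolute value.  Hence per lag `|Γ̂^c(t) − Γ̂(t)| ≤ 4C t |x̄ − c|/(N − t) + (x̄ − c)²` and, over a window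
`W < N`, `|V̂^c_W − V̂_W| ≤ (2W + 1)(x̄ − c)² + 8C |x̄ − c| W²/(N − W)`.  With `c` the pooled mean of `R`
replicas and `x` replica `r`'s series this is the replica-`r` term of Wolff's `Γ̄`; the probabilistic
half (`x̄_r − ā̄ = O_P(n^{−1/2})`, so the bound vanishes in probability under `W_n³/n → 0`) is
`NCMCGeneralSpaceReplicaPooledMeanCentringCoverage`.

## Content (real series `x : ℕ → ℝ`, length `N`, constant `c`, `d_i = Scoring.dev x N i`, `x̄ = Scoring.sampleMean x N`)

* **`lagSum_sub_const_eq`** — `lagSum (x − c) N t = acovSum x N t + (x̄ − c)(Σ_{i<N−t} d_i + Σ_{i<N−t} d_{i+t}) + (N − t)(x̄ − c)²`.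
* `abs_sum_dev_head_le`, `abs_sum_dev_shift_le` — `|Σ_{i<N−t} d_i| ≤ 2C t`, `|Σ_{i<N−t} d_{i+t}| ≤ 2C t` (`t ≤ N`, `|x_i| ≤ C`).
* **`abs_lagSum_sub_const_div_sub_gammaHat_le`** — `t < N`:
  `|lagSum (x − c) N t/(N − t) − gammaHat x N t| ≤ 4C t |x̄ − c|/(N − t) + (x̄ − c)²`.
* **`abs_centredWindow_sub_gammaWindow_le`** — `W < N`:
  `|(lagSum (x − c) N 0/N + 2 Σ_{t<W} lagSum (x − c) N (t+1)/(N − (t+1))) − Γ̂_N(0) · 2τ̂_{N,W}|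
   ≤ (2W + 1)(x̄ − c)² + 8C |x̄ − c| W²/(N − W)`.
* **`abs_pooledCentredWindow_sub_pooledGammaWindow_le`** — the replica average of the previous bound,
  for `R` series `y r` of common length `n` centred at their pooled mean
  `m̄ = (Σ_r Σ_{i<n} y r i)/(R n)`: Wolff's `Γ̄`-window minus the replica-averaged window is at most
  `(1/R) Σ_r [(2W + 1)(ȳ_r − m̄)² + 8C |ȳ_r − m̄| W²/(n − W)]`.

NOT CLAIMED: Wolff's bias correction factor `1 + (2W+1)/N` and his automatic window; unequal replica
lengths; anything probabilistic (see the companion file); anything numerical.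
-/

namespace Summit.Ventures.LatticeQCDFlow.Exactness.GeneralNCMC

open Finset
open scoped BigOperators

/-! ## §1 Re-centring a lag sum at an arbitrary constant -/

section Series

variable (x : ℕ → ℝ) (c : ℝ) (N : ℕ)

/-- **Re-centring identity**: `Σ_{i<N−t} (x_i − c)(x_{i+t} − c)
 = acovSum x N t + (x̄ − c)(Σ_{i<N−t} d_i + Σ_{i<N−t} d_{i+t}) + (N − t)(x̄ − c)²`, `d = x − x̄`. -/
theorem lagSum_sub_const_eq (t : ℕ) :
    Scoring.lagSum (fun i => x i - c) N t
      = Scoring.acovSum x N t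
        + (Scoring.sampleMean x N - c)
          * (∑ i ∈ range (N - t), Scoring.dev x N i + ∑ i ∈ range (N - t), Scoring.dev x N (i + t))
        + ((N - t : ℕ) : ℝ) * (Scoring.sampleMean x N - c) ^ 2 := by
  simp only [Scoring.lagSum, Scoring.acovSum, Scoring.dev]
  have hpt : ∀ i, (x i - c) * (x (i + t) - c)
      = (x i - Scoring.sampleMean x N) * (x (i + t) - Scoring.sampleMean x N)
        + ((Scoring.sampleMean x N - c) * (x i - Scoring.sampleMean x N)
          + (Scoring.sampleMean x N - c) * (x (i + t) - Scoring.sampleMean x N))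
        + (Scoring.sampleMean x N - c) ^ 2 := fun i => by ring
  simp_rw [hpt, sum_add_distrib, ← mul_sum, sum_const, card_range, nsmul_eq_mul]
  ring

variable {x N} {C : ℝ}

/-- The head partial sums of the deviations are small: `|Σ_{i<N−t} d_i| ≤ 2C t` for `t ≤ N`,
`|x_i| ≤ C` (`i < N`) — the deviations sum to zero, so the head sum is minus a tail of `t` terms. -/
theorem abs_sum_dev_head_le (hC : 0 ≤ C) (hx : ∀ i < N, |x i| ≤ C) {t : ℕ} (ht : t ≤ N) :
    |∑ i ∈ range (N - t), Scoring.dev x N i| ≤ 2 * C * t := by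
  rcases Nat.eq_zero_or_pos N with hN | hN
  · subst hN
    have : t = 0 := Nat.le_zero.1 ht
    subst this
    simp
  have hsplit := sum_range_add_sum_Ico (fun i => Scoring.dev x N i) (Nat.sub_le N t)
  rw [Scoring.sum_dev_eq_zero x hN.ne'] at hsplit
  have hhead : ∑ i ∈ range (N - t), Scoring.dev x N i = -∑ i ∈ Ico (N - t) N, Scoring.dev x N i := by
    linarith
  rw [hhead, abs_neg]
  calc |∑ i ∈ Ico (N - t) N, Scoring.dev x N i| ≤ ∑ i ∈ Ico (N - t) N, |Scoring.dev x N i| :=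
        abs_sum_le_sum_abs _ _
    _ ≤ ∑ _i ∈ Ico (N - t) N, 2 * C :=
        sum_le_sum fun i hi => abs_dev_le_of_forall_lt hC hx (mem_Ico.1 hi).2
    _ = 2 * C * t := by
        rw [sum_const, Nat.card_Ico, nsmul_eq_mul, show N - (N - t) = t by omega]
        ring

/-- The shifted partial sums are small too: `|Σ_{i<N−t} d_{i+t}| ≤ 2C t` for `t ≤ N`. -/
theorem abs_sum_dev_shift_le (hC : 0 ≤ C) (hx : ∀ i < N, |x i| ≤ C) {t : ℕ} (ht : t ≤ N) :
    |∑ i ∈ range (N - t), Scoring.dev x N (i + t)| ≤ 2 * C * t := by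
  rcases Nat.eq_zero_or_pos N with hN | hN
  · subst hN
    have : t = 0 := Nat.le_zero.1 ht
    subst this
    simp
  -- `Σ_{i<N−t} d_{i+t} = Σ_{t ≤ j < N} d_j = −Σ_{j<t} d_j`
  have hshift : ∑ i ∈ range (N - t), Scoring.dev x N (i + t) = ∑ j ∈ Ico t N, Scoring.dev x N j := by
    rw [sum_Ico_eq_sum_range]
    exact sum_congr rfl fun i _ => by rw [add_comm]
  have hsplit := sum_range_add_sum_Ico (fun i => Scoring.dev x N i) ht
  rw [Scoring.sum_dev_eq_zero x hN.ne'] at hsplit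
  have htail : ∑ j ∈ Ico t N, Scoring.dev x N j = -∑ j ∈ range t, Scoring.dev x N j := by linarith
  rw [hshift, htail, abs_neg]
  calc |∑ j ∈ range t, Scoring.dev x N j| ≤ ∑ j ∈ range t, |Scoring.dev x N j| :=
        abs_sum_le_sum_abs _ _
    _ ≤ ∑ _j ∈ range t, 2 * C :=
        sum_le_sum fun j hj => abs_dev_le_of_forall_lt hC hx (lt_of_lt_of_le (mem_range.1 hj) ht)
    _ = 2 * C * t := by rw [sum_const, card_range, nsmul_eq_mul]; ring

/-- **Per lag**: for `t < N`, `|Σ_{i<N−t}(x_i − c)(x_{i+t} − c)/(N − t) − Γ̂_N(t)| ≤ 4C t |x̄ − c|/(N − t) + (x̄ − c)²`. -/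
theorem abs_lagSum_sub_const_div_sub_gammaHat_le (hC : 0 ≤ C) (hx : ∀ i < N, |x i| ≤ C)
    (c : ℝ) {t : ℕ} (ht : t < N) :
    |Scoring.lagSum (fun i => x i - c) N t / ((N - t : ℕ) : ℝ) - Scoring.gammaHat x N t|
      ≤ 4 * C * t * |Scoring.sampleMean x N - c| / ((N - t : ℕ) : ℝ)
        + (Scoring.sampleMean x N - c) ^ 2 := by
  have hpos : (0 : ℝ) < ((N - t : ℕ) : ℝ) := by exact_mod_cast Nat.sub_pos_of_lt ht
  set δ := Scoring.sampleMean x N - c with hδ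
  set A := ∑ i ∈ range (N - t), Scoring.dev x N i with hA
  set B := ∑ i ∈ range (N - t), Scoring.dev x N (i + t) with hB
  have hAB : |A + B| ≤ 4 * C * t := by
    calc |A + B| ≤ |A| + |B| := abs_add_le _ _
      _ ≤ 2 * C * t + 2 * C * t :=
          add_le_add (abs_sum_dev_head_le hC hx ht.le) (abs_sum_dev_shift_le hC hx ht.le)
      _ = 4 * C * t := by ring
  unfold Scoring.gammaHat
  rw [lagSum_sub_const_eq x c N t, ← hδ, ← hA, ← hB]
  have hsplit : (Scoring.acovSum x N t + δ * (A + B) + ((N - t : ℕ) : ℝ) * δ ^ 2) / ((N - t : ℕ) : ℝ)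
      - Scoring.acovSum x N t / ((N - t : ℕ) : ℝ) = δ * (A + B) / ((N - t : ℕ) : ℝ) + δ ^ 2 := by
    field_simp
    ring
  rw [hsplit]
  calc |δ * (A + B) / ((N - t : ℕ) : ℝ) + δ ^ 2|
      ≤ |δ * (A + B) / ((N - t : ℕ) : ℝ)| + |δ ^ 2| := abs_add_le _ _
    _ = |δ| * |A + B| / ((N - t : ℕ) : ℝ) + δ ^ 2 := by
        rw [abs_div, abs_mul, abs_of_pos hpos, abs_of_nonneg (sq_nonneg δ)]
    _ ≤ |δ| * (4 * C * t) / ((N - t : ℕ) : ℝ) + δ ^ 2 := by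
        gcongr
    _ = 4 * C * t * |δ| / ((N - t : ℕ) : ℝ) + δ ^ 2 := by ring

/-- **Over a window** `W < N`: the `c`-centred windowed autocovariance sum and scorer A's
`Γ̂_N(0) · 2 τ̂_{N,W}` differ by at most `(2W + 1)(x̄ − c)² + 8C |x̄ − c| W²/(N − W)`. -/
theorem abs_centredWindow_sub_gammaWindow_le (hC : 0 ≤ C) (hx : ∀ i < N, |x i| ≤ C) (c : ℝ)
    {W : ℕ} (hW : W < N) :
    |(Scoring.lagSum (fun i => x i - c) N 0 / ((N - 0 : ℕ) : ℝ)
        + 2 * ∑ t ∈ range W, Scoring.lagSum (fun i => x i - c) N (t + 1) / ((N - (t + 1) : ℕ) : ℝ))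
      - Scoring.gammaHat x N 0 * (2 * Scoring.tauIntWindow (Scoring.rhoHat x N) W)|
      ≤ (2 * W + 1) * (Scoring.sampleMean x N - c) ^ 2
        + 8 * C * |Scoring.sampleMean x N - c| * (W : ℝ) ^ 2 / ((N - W : ℕ) : ℝ) := by
  set δ := Scoring.sampleMean x N - c with hδ
  have hNW : (0 : ℝ) < ((N - W : ℕ) : ℝ) := by exact_mod_cast Nat.sub_pos_of_lt hW
  rw [← gammaWindow_eq_gammaHat_mul_tauIntWindow x N W]
  -- split the difference lag by lag
  have hsplit : (Scoring.lagSum (fun i => x i - c) N 0 / ((N - 0 : ℕ) : ℝ)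
        + 2 * ∑ t ∈ range W, Scoring.lagSum (fun i => x i - c) N (t + 1) / ((N - (t + 1) : ℕ) : ℝ))
      - (Scoring.gammaHat x N 0 + 2 * ∑ t ∈ range W, Scoring.gammaHat x N (t + 1))
      = (Scoring.lagSum (fun i => x i - c) N 0 / ((N - 0 : ℕ) : ℝ) - Scoring.gammaHat x N 0)
        + 2 * ∑ t ∈ range W, (Scoring.lagSum (fun i => x i - c) N (t + 1) / ((N - (t + 1) : ℕ) : ℝ)
          - Scoring.gammaHat x N (t + 1)) := by
    rw [sum_sub_distrib]
    ring
  rw [hsplit]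
  -- lag 0
  have h0 : |Scoring.lagSum (fun i => x i - c) N 0 / ((N - 0 : ℕ) : ℝ) - Scoring.gammaHat x N 0|
      ≤ δ ^ 2 := by
    have h := abs_lagSum_sub_const_div_sub_gammaHat_le hC hx c (lt_of_le_of_lt (Nat.zero_le W) hW)
    simpa [← hδ] using h
  -- lags `1 … W`: each `≤ 4C W |δ|/(N − W) + δ²`
  have ht : ∀ t ∈ range W, |Scoring.lagSum (fun i => x i - c) N (t + 1) / ((N - (t + 1) : ℕ) : ℝ)
      - Scoring.gammaHat x N (t + 1)| ≤ 4 * C * W * |δ| / ((N - W : ℕ) : ℝ) + δ ^ 2 := by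
    intro t htW
    have htW' : t + 1 ≤ W := mem_range.1 htW
    have htN : t + 1 < N := lt_of_le_of_lt htW' hW
    have h := abs_lagSum_sub_const_div_sub_gammaHat_le hC hx c htN
    rw [← hδ] at h
    refine h.trans (add_le_add ?_ le_rfl)
    have hden : ((N - W : ℕ) : ℝ) ≤ ((N - (t + 1) : ℕ) : ℝ) := by
      exact_mod_cast Nat.sub_le_sub_left htW' N
    have htWr : ((t + 1 : ℕ) : ℝ) ≤ W := by exact_mod_cast htW'
    calc 4 * C * ((t + 1 : ℕ) : ℝ) * |δ| / ((N - (t + 1) : ℕ) : ℝ)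
        ≤ 4 * C * W * |δ| / ((N - (t + 1) : ℕ) : ℝ) := by gcongr
      _ ≤ 4 * C * W * |δ| / ((N - W : ℕ) : ℝ) := by
          apply div_le_div_of_nonneg_left _ hNW hden
          positivity
  calc |(Scoring.lagSum (fun i => x i - c) N 0 / ((N - 0 : ℕ) : ℝ) - Scoring.gammaHat x N 0)
        + 2 * ∑ t ∈ range W, (Scoring.lagSum (fun i => x i - c) N (t + 1) / ((N - (t + 1) : ℕ) : ℝ)
          - Scoring.gammaHat x N (t + 1))|
      ≤ |Scoring.lagSum (fun i => x i - c) N 0 / ((N - 0 : ℕ) : ℝ) - Scoring.gammaHat x N 0|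
        + |2 * ∑ t ∈ range W, (Scoring.lagSum (fun i => x i - c) N (t + 1) / ((N - (t + 1) : ℕ) : ℝ)
          - Scoring.gammaHat x N (t + 1))| := abs_add_le _ _
    _ ≤ δ ^ 2 + 2 * ∑ t ∈ range W, (4 * C * W * |δ| / ((N - W : ℕ) : ℝ) + δ ^ 2) := by
        refine add_le_add h0 ?_
        rw [abs_mul, abs_of_pos (by norm_num : (0 : ℝ) < 2)]
        refine mul_le_mul_of_nonneg_left ((abs_sum_le_sum_abs _ _).trans (sum_le_sum ht)) (by norm_num)
    _ = (2 * W + 1) * δ ^ 2 + 8 * C * |δ| * (W : ℝ) ^ 2 / ((N - W : ℕ) : ℝ) := by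
        rw [sum_const, card_range, nsmul_eq_mul]
        field_simp
        ring

end Series

/-! ## §2 `R` series centred at their pooled mean (Wolff's `Γ̄` window) versus the replica average
of scorer A's windows -/

section Replicas

variable {ι : Type*} [Fintype ι]

/-- **Wolff's `Γ̄`-window minus the replica-averaged window, path by path.**  `R = card ι` series
`y r : ℕ → ℝ` of common length `n` with `|y r i| ≤ C`, common window `W < n`, pooled mean
`m̄ = (Σ_r Σ_{i<n} y r i)/(R n)`:
`|(1/R) Σ_r V̂^{m̄}_{r,W} − (1/R) Σ_r Γ̂^r_n(0) · 2 τ̂^r_{n,W}|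
 ≤ (1/R) Σ_r [(2W + 1)(ȳ_r − m̄)² + 8C |ȳ_r − m̄| W²/(n − W)]`. -/
theorem abs_pooledCentredWindow_sub_pooledGammaWindow_le {y : ι → ℕ → ℝ} {n : ℕ} {C : ℝ}
    (hC : 0 ≤ C) (hy : ∀ r, ∀ i < n, |y r i| ≤ C) {W : ℕ} (hW : W < n) :
    |(∑ r, (Scoring.lagSum (fun i => y r i - (∑ r', ∑ i ∈ range n, y r' i) / ((Fintype.card ι : ℝ) * n))
          n 0 / ((n - 0 : ℕ) : ℝ)
        + 2 * ∑ t ∈ range W, Scoring.lagSum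
          (fun i => y r i - (∑ r', ∑ i ∈ range n, y r' i) / ((Fintype.card ι : ℝ) * n)) n (t + 1)
            / ((n - (t + 1) : ℕ) : ℝ))) / Fintype.card ι
      - (∑ r, Scoring.gammaHat (y r) n 0 * (2 * Scoring.tauIntWindow (Scoring.rhoHat (y r) n) W))
          / Fintype.card ι|
      ≤ (∑ r, ((2 * W + 1) * (Scoring.sampleMean (y r) n
            - (∑ r', ∑ i ∈ range n, y r' i) / ((Fintype.card ι : ℝ) * n)) ^ 2
          + 8 * C * |Scoring.sampleMean (y r) n
            - (∑ r', ∑ i ∈ range n, y r' i) / ((Fintype.card ι : ℝ) * n)| * (W : ℝ) ^ 2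
              / ((n - W : ℕ) : ℝ))) / Fintype.card ι := by
  set mbar := (∑ r', ∑ i ∈ range n, y r' i) / ((Fintype.card ι : ℝ) * n) with hm
  have hR : (0 : ℝ) ≤ Fintype.card ι := Nat.cast_nonneg _
  rw [← sub_div, ← sum_sub_distrib, abs_div, abs_of_nonneg hR]
  rcases (Nat.cast_nonneg (α := ℝ) (Fintype.card ι)).lt_or_eq with hRpos | hR0
  · refine div_le_div_of_nonneg_right ((abs_sum_le_sum_abs _ _).trans (sum_le_sum fun r _ => ?_))
      hRpos.le
    exact abs_centredWindow_sub_gammaWindow_le hC (hy r) mbar hW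
  · rw [← hR0, div_zero, div_zero]

end Replicas

end Summit.Ventures.LatticeQCDFlow.Exactness.GeneralNCMC
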